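import Literature.MathematicalPhysics.KineticTheory.SiteChainFokkerPlanckProfiles
import HarnessLib

/-!
# Truncated exponential weights `u ↦ χ(u/R) e^{θu}`: derivatives and uniform exponential bounds

Topic `Literature/MathematicalPhysics/KineticTheory`, grouping namespace `…KineticTheory.HeatConduction`.
One-variable calculus of the truncated Gibbs-type weights used to localise the weight `e^{θH}` of
the backward (transposed) Kolmogorov equation of Langevin chains (`SiteChainResponseBackward*.lean`):
with the smooth decreasing cutoff `χ = smoothCutoff` of `LangevinChainExpBound.lean` (`χ = 1` on
`(-∞,1]`, `χ = 0` on `[2,∞)`) and `F_R(u) = χ(u/R) e^{θu}`: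

* (the vanishing of `χ'`, `χ''` off `[1, 2]` and their global bounds are imported from
  `SiteChainFokkerPlanckProfiles.lean`);
* `hasDerivAt_truncExpWeight`, `hasDerivAt_deriv_truncExpWeight` — the first two derivatives
  `F_R' = e^{θu}(θχ(u/R) + χ'(u/R)/R)`, `F_R'' = e^{θu}(θ²χ(u/R) + 2θχ'(u/R)/R + χ''(u/R)/R²)`;
* `truncExpWeight_derivs_of_lt` — on `u < R` they are `θ e^{θu}`, `θ² e^{θu}`;
  `truncExpWeight_eq_zero_of_le` — `F_R = 0` on `u ≥ 2R`;
* `exists_bound_derivs_truncExpWeight` — `|F_R'|, |F_R''| ≤ A e^{θu}` with ONE constant `A`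
  uniform in `R ≥ 1`; `contDiff_two_truncExpWeight`.

## References

* L. Hörmander, *The Analysis of Linear Partial Differential Operators I* (1990), §1.4 (cutoff
  functions). [folklore]
-/

noncomputable section

open MeasureTheory Filter Topology Set
open scoped ContDiff

namespace Literature.MathematicalPhysics.KineticTheory.HeatConduction

/-! ### The truncated exponential weight `F_R(u) = χ(u/R) e^{θu}` -/

section TruncExpWeight

variable (θ R : ℝ)

/-- `u ↦ χ(u/R)` has derivative `χ'(u/R)/R`. [folklore] -/
theorem hasDerivAt_smoothCutoff_div (u : ℝ) :
    HasDerivAt (fun y => smoothCutoff (y / R)) (deriv smoothCutoff (u / R) / R) u := by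
  have hd : HasDerivAt smoothCutoff (deriv smoothCutoff (u / R)) (u / R) :=
    ((contDiff_smoothCutoff (n := 1)).differentiable (by simp) _).hasDerivAt
  have := hd.comp u ((hasDerivAt_id u).div_const R)
  simpa [Function.comp_def, div_eq_mul_inv, mul_comm] using this

/-- `u ↦ χ'(u/R)/R` has derivative `χ''(u/R)/R²`. [folklore] -/
theorem hasDerivAt_deriv_smoothCutoff_div (u : ℝ) :
    HasDerivAt (fun y => deriv smoothCutoff (y / R) / R) (deriv (deriv smoothCutoff) (u / R) / R ^ 2) u := by
  have hdiff : Differentiable ℝ (deriv smoothCutoff) :=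
    ((contDiff_smoothCutoff (n := 2)).deriv' (n := 1)).differentiable one_ne_zero
  have hd : HasDerivAt (deriv smoothCutoff) (deriv (deriv smoothCutoff) (u / R)) (u / R) :=
    (hdiff _).hasDerivAt
  have := (hd.comp u ((hasDerivAt_id u).div_const R)).div_const R
  refine this.congr_deriv ?_
  simp only [sq]
  ring

/-- **First derivative of the truncated weight**: `F_R' = e^{θu} (θ χ(u/R) + χ'(u/R)/R)`. [folklore] -/
theorem hasDerivAt_truncExpWeight (u : ℝ) :
    HasDerivAt (fun u => smoothCutoff (u / R) * Real.exp (θ * u))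
      (Real.exp (θ * u) * (θ * smoothCutoff (u / R) + deriv smoothCutoff (u / R) / R)) u := by
  have h2 : HasDerivAt (fun y => Real.exp (θ * y)) (θ * Real.exp (θ * u)) u := by
    have := ((hasDerivAt_id u).const_mul θ).exp
    simpa [mul_comm] using this
  exact ((hasDerivAt_smoothCutoff_div R u).mul h2).congr_deriv (by ring)

/-- **Second derivative of the truncated weight**:
`F_R'' = e^{θu} (θ² χ(u/R) + 2θ χ'(u/R)/R + χ''(u/R)/R²)`. [folklore] -/
theorem hasDerivAt_deriv_truncExpWeight (u : ℝ) :
    HasDerivAt (fun u => Real.exp (θ * u) * (θ * smoothCutoff (u / R) + deriv smoothCutoff (u / R) / R))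
      (Real.exp (θ * u) * (θ ^ 2 * smoothCutoff (u / R) + 2 * θ * (deriv smoothCutoff (u / R) / R) +
        deriv (deriv smoothCutoff) (u / R) / R ^ 2)) u := by
  have h2 : HasDerivAt (fun y => Real.exp (θ * y)) (θ * Real.exp (θ * u)) u := by
    have := ((hasDerivAt_id u).const_mul θ).exp
    simpa [mul_comm] using this
  have h3 : HasDerivAt (fun y => θ * smoothCutoff (y / R) + deriv smoothCutoff (y / R) / R)
      (θ * (deriv smoothCutoff (u / R) / R) + deriv (deriv smoothCutoff) (u / R) / R ^ 2) u :=
    ((hasDerivAt_smoothCutoff_div R u).const_mul θ).add (hasDerivAt_deriv_smoothCutoff_div R u)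
  exact (h2.mul h3).congr_deriv (by ring)

variable {θ R}

/-- On `u < R` (`R > 0`) the truncated weight and its first two derivatives are those of `e^{θu}`:
`F_R = e^{θu}`, `F_R' = θ e^{θu}`, `F_R'' = θ² e^{θu}`. [folklore] -/
theorem truncExpWeight_derivs_of_lt (hR : 0 < R) {u : ℝ} (hu : u < R) :
    smoothCutoff (u / R) * Real.exp (θ * u) = Real.exp (θ * u) ∧
      Real.exp (θ * u) * (θ * smoothCutoff (u / R) + deriv smoothCutoff (u / R) / R) =
        θ * Real.exp (θ * u) ∧
      Real.exp (θ * u) * (θ ^ 2 * smoothCutoff (u / R) + 2 * θ * (deriv smoothCutoff (u / R) / R) +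
        deriv (deriv smoothCutoff) (u / R) / R ^ 2) = θ ^ 2 * Real.exp (θ * u) := by
  have h1 : smoothCutoff (u / R) = 1 := smoothCutoff_of_le_one ((div_le_one hR).2 hu.le)
  have h2 : deriv smoothCutoff (u / R) = 0 :=
    deriv_smoothCutoff_eq_zero_of_lt_or_lt (Or.inl ((div_lt_one hR).2 hu))
  have h3 : deriv (deriv smoothCutoff) (u / R) = 0 :=
    deriv_deriv_smoothCutoff_eq_zero_of_lt_or_lt (Or.inl ((div_lt_one hR).2 hu))
  rw [h1, h2, h3]
  refine ⟨by ring, by ring, by ring⟩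

/-- The truncated weight vanishes on `u ≥ 2R` (`R > 0`) and is dominated by `e^{θu}` everywhere.
[folklore] -/
theorem truncExpWeight_eq_zero_of_le (hR : 0 < R) {u : ℝ} (hu : 2 * R ≤ u) :
    smoothCutoff (u / R) * Real.exp (θ * u) = 0 := by
  rw [smoothCutoff_of_two_le ((le_div_iff₀ hR).2 hu), zero_mul]

/-- `0 ≤ χ(u/R) e^{θu} ≤ e^{θu}`. [folklore] -/
theorem truncExpWeight_mem_Icc (R u : ℝ) :
    smoothCutoff (u / R) * Real.exp (θ * u) ∈ Icc 0 (Real.exp (θ * u)) :=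
  ⟨mul_nonneg (smoothCutoff_nonneg _) (Real.exp_pos _).le,
    mul_le_of_le_one_left (Real.exp_pos _).le (smoothCutoff_le_one _)⟩

/-- **Uniform exponential bounds of the derivatives of the truncated weight**: there is ONE constant
`A ≥ 0` (depending on `θ` only) with `|F_R'(u)| ≤ A e^{θu}` and `|F_R''(u)| ≤ A e^{θu}` for all
`R ≥ 1` and all `u`. [folklore] -/
theorem exists_bound_derivs_truncExpWeight (θ : ℝ) :
    ∃ A : ℝ, 0 ≤ A ∧ ∀ R : ℝ, 1 ≤ R → ∀ u : ℝ,
      |Real.exp (θ * u) * (θ * smoothCutoff (u / R) + deriv smoothCutoff (u / R) / R)| ≤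
          A * Real.exp (θ * u) ∧
        |Real.exp (θ * u) * (θ ^ 2 * smoothCutoff (u / R) + 2 * θ * (deriv smoothCutoff (u / R) / R) +
            deriv (deriv smoothCutoff) (u / R) / R ^ 2)| ≤ A * Real.exp (θ * u) := by
  obtain ⟨S, hS0, hS1, hS2⟩ := exists_bound_derivs_smoothCutoff
  refine ⟨|θ| + S + (θ ^ 2 + 2 * |θ| * S + S), by positivity, fun R hR u => ?_⟩
  have hE := Real.exp_pos (θ * u)
  have hR0 : 0 < R := one_pos.trans_le hR
  have hR2 : 1 ≤ R ^ 2 := by nlinarith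
  have hχ0 := smoothCutoff_nonneg (u / R)
  have hχ1 := smoothCutoff_le_one (u / R)
  have hd1 : |deriv smoothCutoff (u / R) / R| ≤ S := by
    rw [abs_div, abs_of_pos hR0]
    exact (div_le_self (abs_nonneg _) hR).trans (hS1 _)
  have hd2 : |deriv (deriv smoothCutoff) (u / R) / R ^ 2| ≤ S := by
    rw [abs_div, abs_of_pos (by positivity : (0:ℝ) < R ^ 2)]
    exact (div_le_self (abs_nonneg _) hR2).trans (hS2 _)
  have hθχ : |θ * smoothCutoff (u / R)| ≤ |θ| := by
    rw [abs_mul, abs_of_nonneg hχ0]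
    exact mul_le_of_le_one_right (abs_nonneg _) hχ1
  have hθ2χ : |θ ^ 2 * smoothCutoff (u / R)| ≤ θ ^ 2 := by
    rw [abs_mul, abs_of_nonneg hχ0, abs_of_nonneg (sq_nonneg θ)]
    exact mul_le_of_le_one_right (sq_nonneg θ) hχ1
  have h2θ : |2 * θ * (deriv smoothCutoff (u / R) / R)| ≤ 2 * |θ| * S := by
    rw [abs_mul, abs_mul, abs_two]
    exact mul_le_mul_of_nonneg_left hd1 (by positivity)
  constructor
  · rw [abs_mul, abs_of_pos hE, mul_comm]
    refine mul_le_mul_of_nonneg_right ?_ hE.le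
    calc |θ * smoothCutoff (u / R) + deriv smoothCutoff (u / R) / R|
        ≤ |θ * smoothCutoff (u / R)| + |deriv smoothCutoff (u / R) / R| := abs_add_le _ _
      _ ≤ |θ| + S := add_le_add hθχ hd1
      _ ≤ |θ| + S + (θ ^ 2 + 2 * |θ| * S + S) := le_add_of_nonneg_right (by positivity)
  · rw [abs_mul, abs_of_pos hE, mul_comm]
    refine mul_le_mul_of_nonneg_right ?_ hE.le
    calc |θ ^ 2 * smoothCutoff (u / R) + 2 * θ * (deriv smoothCutoff (u / R) / R) +
          deriv (deriv smoothCutoff) (u / R) / R ^ 2|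
        ≤ |θ ^ 2 * smoothCutoff (u / R) + 2 * θ * (deriv smoothCutoff (u / R) / R)| +
            |deriv (deriv smoothCutoff) (u / R) / R ^ 2| := abs_add_le _ _
      _ ≤ (|θ ^ 2 * smoothCutoff (u / R)| + |2 * θ * (deriv smoothCutoff (u / R) / R)|) +
            |deriv (deriv smoothCutoff) (u / R) / R ^ 2| := add_le_add (abs_add_le _ _) le_rfl
      _ ≤ (θ ^ 2 + 2 * |θ| * S) + S := add_le_add (add_le_add hθ2χ h2θ) hd2
      _ ≤ |θ| + S + (θ ^ 2 + 2 * |θ| * S + S) := le_add_of_nonneg_left (by positivity)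

/-- The truncated weight is `C²` (indeed smooth). [folklore] -/
theorem contDiff_two_truncExpWeight (θ R : ℝ) :
    ContDiff ℝ 2 (fun u => smoothCutoff (u / R) * Real.exp (θ * u)) :=
  (((contDiff_smoothCutoff (n := ⊤)).comp (contDiff_id.div_const R)).mul
    (contDiff_const.mul contDiff_id).exp).of_le (by norm_cast)

end TruncExpWeight

end Literature.MathematicalPhysics.KineticTheory.HeatConduction
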